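import Mathlib.Geometry.Manifold.ContMDiff.Atlas
import Mathlib.Geometry.Manifold.ContMDiff.NormedSpace
import Mathlib.Geometry.Manifold.ContMDiff.Constructions
import Mathlib.Geometry.Manifold.Immersion
import Mathlib.Geometry.Manifold.Diffeomorph
import Literature.Topology.FourManifolds.Gluing
import HarnessLib

/-!
# Long open collars of the boundary (input of the gluing `M ∪_φ N`)

Topic `Literature/Topology/FourManifolds` (fact seat
`provefact-Literature.Topology.FourManifolds.exists_isBoundaryGluing`: the existence of the gluing
`M ∪_φ N` of two compact manifolds with boundary, `Literature.Topology.FourManifolds.exists_isBoundaryGluing`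
of `Gluing.lean`, is assembled — following Milnor, *Lectures on the h-cobordism theorem* (1965),
proof of Thm. 1.4, and Bröcker–Jänich, *Introduction to Differential Topology* (1982), (13.8),
(13.11) — from the open pieces `M - ∂M`, `N - ∂N` and the product `∂M × ℝ`, glued along open
collars of the two boundaries; this file provides the collar input in the form the gluing uses).

A **long open collar** of a boundary datum `b` of `M` (model `𝓡∂ (n + 1)`, boundary model `𝓡 n`,
any `n`, so `dim M = n + 1 ≥ 1`) is a map `toFun : ∂M → ℝ → M`, meaningful on `∂M × [0, ∞)`,
starting at the boundary inclusion, bijective from `∂M × [0, ∞)` onto an open set `region ⊇ ∂M`,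
smooth, and with *both components* `(proj, height)` *of its inverse smooth on* `region`
(Bröcker–Jänich (1982), (13.5)–(13.6): a collar `∂M × [0, 1) ≅` open neighbourhood of `∂M`, "if we
so wish, we can map `∂M × ℝ₊`"; Milnor (1965), proof of Thm. 3.4: `h(y₀, s) = ψ_{y₀}(s)`,
`h⁻¹(y) = (ψ_y(0), f(y))`).  This is the structure `Literature.Topology.FourManifolds.BoundaryData.OpenCollarData`
of `CollarCriterion.lean` (which is stated for `dim M = n + 2 ≥ 2` and a finite height `top > 1`,
being geared to the closed collar `∂M × [0, 1]` with corners) with the parameter running over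
`[0, ∞)` and in every dimension `n + 1 ≥ 1`; existence on compact manifolds is proved in
`OpenCollarExistence.lean`.

## Main definitions and results (all proved)

* `Literature.Topology.FourManifolds.BoundaryData.OpenCollar b` — the structure.
* `OpenCollar.mem_region_iff`, `height_eq_zero_iff`, `isInteriorPoint_apply`,
  `boundary_subset_region`, `isInteriorPoint_of_not_mem_region` — bookkeeping.
* `OpenCollar.leftChart φ₀`, `leftChart_mem_maximalAtlas` — the chart
  `z ↦ (height z, φ₀ (proj z)) ∈ ℝⁿ⁺¹₊` of `M` on `region ∩ proj ⁻¹' φ₀.source` adapted to the collar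
  (copied from `CollarCriterion.lean` in dimension `n + 1`).
* `OpenCollar.projHeight`, `isImmersionAtOfComplement_projHeight` — the inverse
  `z ↦ (proj z, height z) : M → ∂M × ℝ` is a `C^∞` immersion (Mathlib's chart-wise sense, complement
  `PUnit`) at every point of `region`: in `leftChart φ₀` and the product chart `φ₀ × id` it is the
  linear map `v ↦ (tail v, v 0)`.

## References

* T. Bröcker, K. Jänich, *Introduction to Differential Topology*, CUP (1982), (13.5), (13.6).
  [BrockerJanich1982]
* J. Milnor, *Lectures on the h-cobordism theorem*, Princeton (1965), §1 and proof of Thm. 3.4.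
  [MilnorHCobordism1965]
-/

open scoped Manifold ContDiff Topology
open Set Function

noncomputable section

namespace Literature.Topology.FourManifolds

universe u

/-! ### Transporting a chart along a diffeomorphism -/

section Transport

variable {E H : Type*} [NormedAddCommGroup E] [NormedSpace ℝ E] [TopologicalSpace H]
  {I : ModelWithCorners ℝ E H} {X : Type*} [TopologicalSpace X] [ChartedSpace H X]
  {X' : Type*} [TopologicalSpace X'] [ChartedSpace H X'] {m : WithTop ℕ∞}

/-- **Transport of a maximal-atlas chart along a diffeomorphism**: if `c` is a chart of the
maximal `C^m` atlas of `X` and `Φ : X' ≅ X` is a `C^m` diffeomorphism (same model), then `c ∘ Φ`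
is a chart of the maximal `C^m` atlas of `X'` (both it and its inverse `Φ⁻¹ ∘ c⁻¹` are `C^m`;
Mathlib's `IsManifold.mem_maximalAtlas_iff_contMDiffOn`). [folklore] -/
theorem trans_mem_maximalAtlas_of_diffeomorph [IsManifold I m X] [IsManifold I m X']
    (Φ : X' ≃ₘ^m⟮I, I⟯ X) {c : OpenPartialHomeomorph X H} (hc : c ∈ IsManifold.maximalAtlas I m X) :
    Φ.toHomeomorph.toOpenPartialHomeomorph ≫ₕ c ∈ IsManifold.maximalAtlas I m X' := by
  set c' : OpenPartialHomeomorph X' H := Φ.toHomeomorph.toOpenPartialHomeomorph ≫ₕ c with hc'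
  rw [IsManifold.mem_maximalAtlas_iff_contMDiffOn]
  constructor
  · have h1 := contMDiffOn_of_mem_maximalAtlas hc
    have : ContMDiffOn I I m (c ∘ Φ) c'.source := by
      refine h1.comp Φ.contMDiff.contMDiffOn ?_
      intro y hy
      simpa [hc'] using hy
    exact this.congr fun y _ => by simp [hc']
  · have h1 := contMDiffOn_symm_of_mem_maximalAtlas hc
    have : ContMDiffOn I I m (Φ.symm ∘ c.symm) c'.target := by
      refine Φ.symm.contMDiff.comp_contMDiffOn (h1.mono ?_)
      intro y hy
      simpa [hc'] using hy
    exact this.congr fun y _ => by simp [hc']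

end Transport

namespace BoundaryData

variable {n : ℕ} {M : Type u} [TopologicalSpace M] [ChartedSpace (EuclideanHalfSpace (n + 1)) M]

/-- **Long open collar** of a boundary datum `b` of `M` (`dim M = n + 1`): a map
`toFun : ∂M → ℝ → M` with `toFun x 0 = incl x`, sending `∂M × [0, ∞)` bijectively onto the open
set `region`, with inverse `z ↦ (proj z, height z)` there; `toFun` is `C^∞` on `∂M × [0, ∞)`
(product model `(𝓡 n) × 𝓘(ℝ, ℝ)`, target model `𝓡∂ (n + 1)`) and `proj`, `height` are `C^∞` on
`region`. Bröcker–Jänich (1982), (13.5)–(13.6) (collar `∂M × ℝ₊ → M`); Milnor (1965), proof of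
Thm. 3.4 (`h`, `h⁻¹ = (ψ_y(0), f)`). [cite: BrockerJanich1982, (13.5)-(13.6)] -/
structure OpenCollar (b : BoundaryData (𝓡∂ (n + 1)) M (𝓡 n)) where
  /-- The open collar map `∂M × ℝ → M` (only its values on `∂M × [0, ∞)` matter). -/
  toFun : b.carrier → ℝ → M
  /-- The boundary component of the inverse. -/
  proj : M → b.carrier
  /-- The height component of the inverse. -/
  height : M → ℝ
  /-- The image of `∂M × [0, ∞)`. -/
  region : Set M
  isOpen_region : IsOpen region
  apply_zero : ∀ x, toFun x 0 = b.incl x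
  mem_region : ∀ x t, 0 ≤ t → toFun x t ∈ region
  proj_apply : ∀ x t, 0 ≤ t → proj (toFun x t) = x
  height_apply : ∀ x t, 0 ≤ t → height (toFun x t) = t
  height_nonneg : ∀ z ∈ region, 0 ≤ height z
  apply_proj_height : ∀ z ∈ region, toFun (proj z) (height z) = z
  contMDiffOn_toFun : ContMDiffOn ((𝓡 n).prod 𝓘(ℝ, ℝ)) (𝓡∂ (n + 1)) ∞ (uncurry toFun)
    (univ ×ˢ Ici 0)
  contMDiffOn_proj : ContMDiffOn (𝓡∂ (n + 1)) (𝓡 n) ∞ proj region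
  contMDiffOn_height : ContMDiffOn (𝓡∂ (n + 1)) 𝓘(ℝ, ℝ) ∞ height region

namespace OpenCollar

variable {b : BoundaryData (𝓡∂ (n + 1)) M (𝓡 n)} (D : b.OpenCollar)

/-! ### Bookkeeping -/

/-- The open collar map is continuous on `∂M × [0, ∞)`. [folklore] -/
theorem continuousOn_toFun : ContinuousOn (uncurry D.toFun) (univ ×ˢ Ici 0) :=
  D.contMDiffOn_toFun.continuousOn

/-- The boundary component of the inverse is continuous on `region`. [folklore] -/
theorem continuousOn_proj : ContinuousOn D.proj D.region := D.contMDiffOn_proj.continuousOn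

/-- The height component of the inverse is continuous on `region`. [folklore] -/
theorem continuousOn_height : ContinuousOn D.height D.region := D.contMDiffOn_height.continuousOn

/-- The injectivity relations: `toFun x t = toFun x' t'` forces `x = x'` and `t = t'`. [folklore] -/
theorem eq_of_apply_eq {x x' : b.carrier} {t t' : ℝ} (ht : 0 ≤ t) (ht' : 0 ≤ t')
    (h : D.toFun x t = D.toFun x' t') : x = x' ∧ t = t' := by
  constructor
  · rw [← D.proj_apply x t ht, h, D.proj_apply x' t' ht']
  · rw [← D.height_apply x t ht, h, D.height_apply x' t' ht']

/-- `region` is exactly the image of `∂M × [0, ∞)`. [folklore] -/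
theorem mem_region_iff {z : M} : z ∈ D.region ↔ ∃ x t, 0 ≤ t ∧ D.toFun x t = z :=
  ⟨fun hz => ⟨D.proj z, D.height z, D.height_nonneg z hz, D.apply_proj_height z hz⟩,
    fun ⟨x, t, ht, h⟩ => h ▸ D.mem_region x t ht⟩

/-- The boundary inclusion lands in `region`. [folklore] -/
theorem incl_mem_region (x : b.carrier) : b.incl x ∈ D.region := by
  rw [← D.apply_zero]
  exact D.mem_region x 0 le_rfl

/-- `proj (incl x) = x`. [folklore] -/
@[simp] theorem proj_incl (x : b.carrier) : D.proj (b.incl x) = x := by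
  rw [← D.apply_zero, D.proj_apply x 0 le_rfl]

/-- `height (incl x) = 0`. [folklore] -/
@[simp] theorem height_incl (x : b.carrier) : D.height (b.incl x) = 0 := by
  rw [← D.apply_zero, D.height_apply x 0 le_rfl]

/-- The boundary of `M` lies in `region`. [folklore] -/
theorem boundary_subset_region : (𝓡∂ (n + 1)).boundary M ⊆ D.region := by
  rw [← b.range_incl]
  rintro _ ⟨x, rfl⟩
  exact D.incl_mem_region x

/-- On `region`, the height vanishes exactly on the boundary. [folklore] -/
theorem height_eq_zero_iff {z : M} (hz : z ∈ D.region) :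
    D.height z = 0 ↔ z ∈ (𝓡∂ (n + 1)).boundary M := by
  constructor
  · intro h
    rw [← b.range_incl, ← D.apply_proj_height z hz, h, D.apply_zero]
    exact mem_range_self _
  · rw [← b.range_incl]
    rintro ⟨x, rfl⟩
    exact D.height_incl x

/-- On `region`, the height is positive exactly off the boundary. [folklore] -/
theorem height_pos_iff {z : M} (hz : z ∈ D.region) :
    0 < D.height z ↔ z ∉ (𝓡∂ (n + 1)).boundary M := by
  rw [← D.height_eq_zero_iff hz, (D.height_nonneg z hz).lt_iff_ne', ne_eq]

/-- Points of positive collar parameter are interior points of `M`. [folklore] -/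
theorem isInteriorPoint_apply (x : b.carrier) {t : ℝ} (ht : 0 < t) :
    (𝓡∂ (n + 1)).IsInteriorPoint (D.toFun x t) := by
  rw [ModelWithCorners.isInteriorPoint_iff_not_isBoundaryPoint]
  intro h
  have h' : D.toFun x t ∈ (𝓡∂ (n + 1)).boundary M := h
  rw [← D.height_eq_zero_iff (D.mem_region x t ht.le), D.height_apply x t ht.le] at h'
  exact ht.ne' h'

/-- A point of `region` with positive height is an interior point. [folklore] -/
theorem isInteriorPoint_of_height_pos {z : M} (hz : z ∈ D.region) (h : 0 < D.height z) :
    (𝓡∂ (n + 1)).IsInteriorPoint z := by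
  rw [← D.apply_proj_height z hz]
  exact D.isInteriorPoint_apply _ h

/-- Points outside `region` are interior points (the boundary lies in `region`). [folklore] -/
theorem isInteriorPoint_of_not_mem_region {z : M} (hz : z ∉ D.region) :
    (𝓡∂ (n + 1)).IsInteriorPoint z := by
  rw [ModelWithCorners.isInteriorPoint_iff_not_isBoundaryPoint]
  exact fun h => hz (D.boundary_subset_region h)

/-- An interior point of `region` has positive height. [folklore] -/
theorem height_pos_of_isInteriorPoint {z : M} (hz : z ∈ D.region)
    (h : (𝓡∂ (n + 1)).IsInteriorPoint z) : 0 < D.height z := by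
  rw [D.height_pos_iff hz]
  intro h'
  exact ((𝓡∂ (n + 1)).isInteriorPoint_iff_not_isBoundaryPoint z).1 h h'

/-- The set of points of `region` of positive height is open. [folklore] -/
theorem isOpen_region_inter_height_pos : IsOpen (D.region ∩ {z | 0 < D.height z}) :=
  D.continuousOn_height.isOpen_inter_preimage D.isOpen_region isOpen_Ioi

/-! ### The inverse `(proj, height)` as a map to `∂M × ℝ` -/

/-- The inverse of the collar, `z ↦ (proj z, height z) : M → ∂M × ℝ` (meaningful on `region`).
[folklore] -/
def projHeight (z : M) : b.carrier × ℝ := (D.proj z, D.height z)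

/-- Formula for `projHeight` (definitional). [folklore] -/
@[simp] theorem projHeight_apply (z : M) : D.projHeight z = (D.proj z, D.height z) := rfl

/-- `projHeight` is continuous on `region`. [folklore] -/
theorem continuousOn_projHeight : ContinuousOn D.projHeight D.region :=
  D.continuousOn_proj.prodMk D.continuousOn_height

/-- `projHeight` is smooth on `region`. [folklore] -/
theorem contMDiffOn_projHeight :
    ContMDiffOn (𝓡∂ (n + 1)) ((𝓡 n).prod 𝓘(ℝ, ℝ)) ∞ D.projHeight D.region :=
  D.contMDiffOn_proj.prodMk D.contMDiffOn_height

/-- `projHeight (toFun x t) = (x, t)` for `t ≥ 0`. [folklore] -/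
theorem projHeight_apply_toFun (x : b.carrier) {t : ℝ} (ht : 0 ≤ t) :
    D.projHeight (D.toFun x t) = (x, t) :=
  Prod.ext (D.proj_apply x t ht) (D.height_apply x t ht)

/-- `toFun` inverts `projHeight` on `region`. [folklore] -/
theorem uncurry_toFun_projHeight {z : M} (hz : z ∈ D.region) :
    uncurry D.toFun (D.projHeight z) = z :=
  D.apply_proj_height z hz

/-! ### The chart of `M` adapted to the collar -/

section LeftChart

variable (φ₀ : OpenPartialHomeomorph b.carrier (EuclideanSpace ℝ (Fin n)))

/-- The vector `(max (height z) 0, φ₀ (proj z)) ∈ ℝⁿ⁺¹` (on `region`, where `height ≥ 0`, this is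
`(height z, φ₀ (proj z))`). [folklore] -/
def leftVec (z : M) : EuclideanSpace ℝ (Fin (n + 1)) :=
  BoundaryManifold.consCLE n (φ₀ (D.proj z), max (D.height z) 0)

/-- The coordinate `0` of `leftVec` is `max (height z) 0`. [folklore] -/
theorem leftVec_apply_zero (z : M) : D.leftVec φ₀ z 0 = max (D.height z) 0 := rfl

/-- The tail of `leftVec` is `φ₀ (proj z)`. [folklore] -/
theorem tail_leftVec (z : M) : BoundaryManifold.tail n (D.leftVec φ₀ z) = φ₀ (D.proj z) :=
  BoundaryManifold.tail_consCLE _ _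

/-- `leftVec` takes values in the model half-space. [folklore] -/
theorem leftVec_apply_zero_nonneg (z : M) : 0 ≤ D.leftVec φ₀ z 0 := by
  rw [leftVec_apply_zero]
  exact le_max_right _ _

/-- `leftVec` takes values in the range of `𝓡∂ (n + 1)`. [folklore] -/
theorem leftVec_mem_range (z : M) : D.leftVec φ₀ z ∈ range (𝓡∂ (n + 1)) := by
  rw [range_modelWithCornersEuclideanHalfSpace]
  exact D.leftVec_apply_zero_nonneg φ₀ z

/-- On `region` the coordinate `0` of `leftVec` is `height z`. [folklore] -/
theorem leftVec_eq_of_mem {z : M} (hz : z ∈ D.region) :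
    D.leftVec φ₀ z = BoundaryManifold.consCLE n (φ₀ (D.proj z), D.height z) := by
  rw [leftVec, max_eq_left (D.height_nonneg z hz)]

/-- **The chart of `M` adapted to the collar**: on `region ∩ proj ⁻¹' φ₀.source` the map
`z ↦ (height z, φ₀ (proj z))`, with inverse `v ↦ toFun (φ₀.symm (tail v)) (v 0)`; here `φ₀` is a
chart of `∂M` (Milnor (1965), §1: "`∂M × [0, 1)` is a neighbourhood of `∂M` with the product
structure"). [folklore] -/
def leftChart : OpenPartialHomeomorph M (EuclideanHalfSpace (n + 1)) where
  toFun z := ⟨D.leftVec φ₀ z, D.leftVec_apply_zero_nonneg φ₀ z⟩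
  invFun v := D.toFun (φ₀.symm (BoundaryManifold.tail n v.val)) (v.val 0)
  source := D.region ∩ D.proj ⁻¹' φ₀.source
  target := {v | BoundaryManifold.tail n v.val ∈ φ₀.target}
  map_source' := by
    rintro z ⟨-, hzs⟩
    show BoundaryManifold.tail n (D.leftVec φ₀ z) ∈ φ₀.target
    rw [tail_leftVec]
    exact φ₀.map_source hzs
  map_target' := by
    rintro v hv
    refine ⟨D.mem_region _ _ v.2, ?_⟩
    show D.proj (D.toFun _ _) ∈ φ₀.source
    rw [D.proj_apply _ _ v.2]
    exact φ₀.map_target hv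
  left_inv' := by
    rintro z ⟨hz, hzs⟩
    simp only [leftVec_eq_of_mem D φ₀ hz, BoundaryManifold.tail_consCLE,
      BoundaryManifold.consCLE_apply_zero, φ₀.left_inv hzs]
    exact D.apply_proj_height z hz
  right_inv' := by
    rintro v hv
    apply Subtype.ext
    simp only [leftVec, D.proj_apply _ _ v.2, D.height_apply _ _ v.2, φ₀.right_inv hv,
      max_eq_left v.2]
    exact BoundaryManifold.consCLE_tail n v.val
  open_source := D.continuousOn_proj.isOpen_inter_preimage D.isOpen_region φ₀.open_source
  open_target := by
    have h1 : IsOpen {e : EuclideanSpace ℝ (Fin (n + 1)) | BoundaryManifold.tail n e ∈ φ₀.target} :=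
      φ₀.open_target.preimage (BoundaryManifold.continuous_tail n)
    exact h1.preimage continuous_subtype_val
  continuousOn_toFun := by
    refine Topology.IsInducing.subtypeVal.continuousOn_iff.mpr ?_
    show ContinuousOn (fun z => D.leftVec φ₀ z) (D.region ∩ D.proj ⁻¹' φ₀.source)
    refine (BoundaryManifold.consCLE n).continuous.comp_continuousOn ?_
    refine ContinuousOn.prodMk ?_ ((continuous_id.max continuous_const).comp_continuousOn
      (D.continuousOn_height.mono inter_subset_left))
    exact φ₀.continuousOn.comp (D.continuousOn_proj.mono inter_subset_left) fun z hz => hz.2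
  continuousOn_invFun := by
    have hA : Continuous fun v : EuclideanHalfSpace (n + 1) =>
        (BoundaryManifold.tail n v.val, v.val 0) :=
      ((BoundaryManifold.continuous_tail n).comp continuous_subtype_val).prodMk
        ((PiLp.continuous_apply 2 _ 0).comp continuous_subtype_val)
    have hB : ContinuousOn (fun q : EuclideanSpace ℝ (Fin n) × ℝ => (φ₀.symm q.1, q.2))
        (φ₀.target ×ˢ univ) :=
      (φ₀.continuousOn_symm.comp continuousOn_fst fun q hq => hq.1).prodMk continuousOn_snd
    refine D.continuousOn_toFun.comp (hB.comp hA.continuousOn ?_) ?_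
    · rintro v hv
      exact ⟨hv, mem_univ _⟩
    · rintro v -
      exact ⟨mem_univ _, v.2⟩

/-- The source of `leftChart` (definitional). [folklore] -/
theorem leftChart_source : (D.leftChart φ₀).source = D.region ∩ D.proj ⁻¹' φ₀.source := rfl

/-- `leftChart` as a vector of `ℝⁿ⁺¹` (definitional). [folklore] -/
theorem coe_leftChart (z : M) : (D.leftChart φ₀ z).val = D.leftVec φ₀ z := rfl

/-- The inverse of `leftChart` (definitional). [folklore] -/
theorem leftChart_symm_apply (v : EuclideanHalfSpace (n + 1)) :
    (D.leftChart φ₀).symm v = D.toFun (φ₀.symm (BoundaryManifold.tail n v.val)) (v.val 0) :=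
  rfl

/-- The inverse of the collar chart is smooth (it is `v ↦ toFun (φ₀.symm (tail v)) (v 0)`).
[folklore] -/
theorem contMDiffOn_leftChart_symm (hφ₀ : φ₀ ∈ IsManifold.maximalAtlas (𝓡 n) ∞ b.carrier) :
    ContMDiffOn (𝓡∂ (n + 1)) (𝓡∂ (n + 1)) ∞ (D.leftChart φ₀).symm (D.leftChart φ₀).target := by
  have hI := (𝓡∂ (n + 1)).contMDiff (n := ∞)
  have h1 : ContMDiffOn (𝓡∂ (n + 1)) (𝓡 n) ∞
      (fun v : EuclideanHalfSpace (n + 1) => φ₀.symm (BoundaryManifold.tail n v.val))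
      (D.leftChart φ₀).target := by
    have htail : ContMDiff (𝓡∂ (n + 1)) 𝓘(ℝ, EuclideanSpace ℝ (Fin n)) ∞
        fun v : EuclideanHalfSpace (n + 1) => BoundaryManifold.tail n v.val :=
      (BoundaryManifold.contDiff_tail n).contMDiff.comp hI
    exact (contMDiffOn_symm_of_mem_maximalAtlas hφ₀).comp htail.contMDiffOn fun v hv => hv
  have h2 : ContMDiff (𝓡∂ (n + 1)) 𝓘(ℝ, ℝ) ∞ fun v : EuclideanHalfSpace (n + 1) => v.val 0 :=
    ((EuclideanSpace.proj (0 : Fin (n + 1))).contMDiff).comp hI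
  refine (D.contMDiffOn_toFun.comp (h1.prodMk h2.contMDiffOn) ?_).congr fun v hv => rfl
  rintro v -
  exact ⟨mem_univ _, v.2⟩

/-- The collar chart is smooth (it is `(height, φ₀ ∘ proj)` read in `ℝⁿ⁺¹`). [folklore] -/
theorem contMDiffOn_leftChart (hφ₀ : φ₀ ∈ IsManifold.maximalAtlas (𝓡 n) ∞ b.carrier) :
    ContMDiffOn (𝓡∂ (n + 1)) (𝓡∂ (n + 1)) ∞ (D.leftChart φ₀) (D.leftChart φ₀).source := by
  have hG : ContMDiffOn (𝓡∂ (n + 1)) 𝓘(ℝ, EuclideanSpace ℝ (Fin (n + 1))) ∞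
      (fun z => BoundaryManifold.consCLE n (φ₀ (D.proj z), D.height z))
      (D.leftChart φ₀).source := by
    refine (BoundaryManifold.consCLE n).contDiff.contMDiff.comp_contMDiffOn ?_
    refine ContMDiffOn.prodMk_space ?_ (D.contMDiffOn_height.mono inter_subset_left)
    exact (contMDiffOn_of_mem_maximalAtlas hφ₀).comp (D.contMDiffOn_proj.mono inter_subset_left)
      fun z hz => hz.2
  have hG' : ContMDiffOn (𝓡∂ (n + 1)) 𝓘(ℝ, EuclideanSpace ℝ (Fin (n + 1))) ∞ (D.leftVec φ₀)
      (D.leftChart φ₀).source :=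
    hG.congr fun z hz => D.leftVec_eq_of_mem φ₀ hz.1
  have hsymm := (𝓡∂ (n + 1)).contMDiffOn_symm (n := ∞)
  have hcomp := hsymm.comp hG' fun z _ => D.leftVec_mem_range φ₀ z
  refine hcomp.congr fun z _ => ?_
  show D.leftChart φ₀ z = (𝓡∂ (n + 1)).symm (D.leftVec φ₀ z)
  apply Subtype.ext
  rw [coe_leftChart]
  obtain ⟨w, hw⟩ := D.leftVec_mem_range φ₀ z
  rw [← hw, ModelWithCorners.left_inv]
  rfl

variable [IsManifold (𝓡∂ (n + 1)) ∞ M] in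
/-- The collar chart belongs to the maximal `C^∞` atlas of `M`. [folklore] -/
theorem leftChart_mem_maximalAtlas (hφ₀ : φ₀ ∈ IsManifold.maximalAtlas (𝓡 n) ∞ b.carrier) :
    D.leftChart φ₀ ∈ IsManifold.maximalAtlas (𝓡∂ (n + 1)) ∞ M :=
  (D.leftChart φ₀).mem_maximalAtlas_of_contMDiffOn (D.contMDiffOn_leftChart φ₀ hφ₀)
    (D.contMDiffOn_leftChart_symm φ₀ hφ₀)

/-- In the collar chart `leftChart φ₀` and the product chart `φ₀ × id` of `∂M × ℝ`, the inverse
`projHeight` of the collar reads `v ↦ (tail v, v 0)` on the target of the extended collar chart.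
[folklore] -/
theorem extend_prod_projHeight_leftChart_symm {v : EuclideanSpace ℝ (Fin (n + 1))}
    (hv : v ∈ ((D.leftChart φ₀).extend (𝓡∂ (n + 1))).target) :
    (φ₀.prod (OpenPartialHomeomorph.refl ℝ)).extend ((𝓡 n).prod 𝓘(ℝ, ℝ))
        (D.projHeight (((D.leftChart φ₀).extend (𝓡∂ (n + 1))).symm v)) =
      (BoundaryManifold.tail n v, v 0) := by
  rw [OpenPartialHomeomorph.extend_target] at hv
  obtain ⟨hv₁, hv₂⟩ := hv
  have hv0 : 0 ≤ v 0 := by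
    rw [range_modelWithCornersEuclideanHalfSpace] at hv₂
    exact hv₂
  have hval : ((𝓡∂ (n + 1)).symm v).val = v := by
    have h := (𝓡∂ (n + 1)).right_inv hv₂
    exact h
  rw [OpenPartialHomeomorph.extend_coe_symm, comp_apply, leftChart_symm_apply, hval,
    D.projHeight_apply_toFun _ hv0, OpenPartialHomeomorph.extend_prod,
    PartialEquiv.prod_coe, OpenPartialHomeomorph.extend_coe, OpenPartialHomeomorph.extend_coe]
  simp only [comp_apply, OpenPartialHomeomorph.refl_apply, id_eq, modelWithCornersSelf_coe,
    Prod.mk.injEq, and_true]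
  change BoundaryManifold.tail n ((𝓡∂ (n + 1)).symm v).val ∈ φ₀.target at hv₁
  rw [hval] at hv₁
  exact φ₀.right_inv hv₁

end LeftChart

/-! ### The inverse of the collar is an immersion on `region` -/

variable [IsManifold (𝓡∂ (n + 1)) ∞ M]

/-- **The inverse `(proj, height) : M → ∂M × ℝ` of a long open collar is a `C^∞` immersion at every
point of `region`** (Mathlib's chart-wise immersion property, complement `PUnit`): in the collar
chart `leftChart φ₀` (with `φ₀` the preferred chart of `∂M` at `proj z`) and the product chart
`φ₀ × id` it is the linear isomorphism `v ↦ (tail v, v 0)`. [folklore] -/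
theorem isImmersionAtOfComplement_projHeight {z : M} (hz : z ∈ D.region) :
    Manifold.IsImmersionAtOfComplement PUnit (𝓡∂ (n + 1)) ((𝓡 n).prod 𝓘(ℝ, ℝ)) ∞
      D.projHeight z := by
  set φ₀ := chartAt (EuclideanSpace ℝ (Fin n)) (D.proj z) with hφ₀def
  have hφ₀ : φ₀ ∈ IsManifold.maximalAtlas (𝓡 n) ∞ b.carrier :=
    IsManifold.chart_mem_maximalAtlas (D.proj z)
  have hrefl : OpenPartialHomeomorph.refl ℝ ∈ IsManifold.maximalAtlas 𝓘(ℝ, ℝ) ∞ ℝ :=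
    IsManifold.subset_maximalAtlas (by simp)
  refine Manifold.IsImmersionAtOfComplement.mk_of_continuousAt
    (D.continuousOn_projHeight.continuousAt (D.isOpen_region.mem_nhds hz))
    ((ContinuousLinearEquiv.prodUnique ℝ _ PUnit).trans (BoundaryManifold.consCLE n).symm)
    (D.leftChart φ₀) (φ₀.prod (OpenPartialHomeomorph.refl ℝ)) ?_ ?_
    (D.leftChart_mem_maximalAtlas φ₀ hφ₀) (IsManifold.mem_maximalAtlas_prod hφ₀ hrefl) ?_
  · rw [leftChart_source]
    exact ⟨hz, mem_chart_source _ (D.proj z)⟩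
  · rw [OpenPartialHomeomorph.prod_source]
    exact ⟨mem_chart_source _ (D.proj z), mem_univ _⟩
  · intro v hv
    refine (D.extend_prod_projHeight_leftChart_symm φ₀ hv).trans ?_
    rfl

omit [IsManifold (𝓡∂ (n + 1)) ∞ M] in
/-- In the collar chart `leftChart (ψ ≫ φ₀)` and the product chart `φ₀ × id` of `B' × ℝ`, the
re-indexed and reflected inverse `z ↦ (ψ (proj z), -height z)` of the collar (`ψ : ∂M ≅ B'` a
diffeomorphism, `φ₀` a chart of `B'`) reads `v ↦ (tail v, -v 0)`. [folklore] -/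
theorem extend_prod_reindexNeg_leftChart_symm {B' : Type*} [TopologicalSpace B']
    [ChartedSpace (EuclideanSpace ℝ (Fin n)) B'] (ψ : b.carrier ≃ₘ⟮𝓡 n, 𝓡 n⟯ B')
    (φ₀ : OpenPartialHomeomorph B' (EuclideanSpace ℝ (Fin n))) {v : EuclideanSpace ℝ (Fin (n + 1))}
    (hv : v ∈ ((D.leftChart (ψ.toHomeomorph.toOpenPartialHomeomorph ≫ₕ φ₀)).extend
      (𝓡∂ (n + 1))).target) :
    (φ₀.prod (OpenPartialHomeomorph.refl ℝ)).extend ((𝓡 n).prod 𝓘(ℝ, ℝ))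
        ((fun z => (ψ (D.proj z), -D.height z))
          (((D.leftChart (ψ.toHomeomorph.toOpenPartialHomeomorph ≫ₕ φ₀)).extend
            (𝓡∂ (n + 1))).symm v)) =
      (BoundaryManifold.tail n v, -v 0) := by
  set φ₁ := ψ.toHomeomorph.toOpenPartialHomeomorph ≫ₕ φ₀ with hφ₁
  rw [OpenPartialHomeomorph.extend_target] at hv
  obtain ⟨hv₁, hv₂⟩ := hv
  have hv0 : 0 ≤ v 0 := by
    rw [range_modelWithCornersEuclideanHalfSpace] at hv₂
    exact hv₂
  have hval : ((𝓡∂ (n + 1)).symm v).val = v := by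
    have h := (𝓡∂ (n + 1)).right_inv hv₂
    exact h
  change BoundaryManifold.tail n ((𝓡∂ (n + 1)).symm v).val ∈ φ₁.target at hv₁
  rw [hval] at hv₁
  have hv₁' : BoundaryManifold.tail n v ∈ φ₀.target := by simpa [hφ₁] using hv₁
  rw [OpenPartialHomeomorph.extend_coe_symm, comp_apply, leftChart_symm_apply, hval]
  dsimp only
  rw [D.proj_apply _ _ hv0, D.height_apply _ _ hv0, OpenPartialHomeomorph.extend_prod,
    PartialEquiv.prod_coe, OpenPartialHomeomorph.extend_coe, OpenPartialHomeomorph.extend_coe]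
  simp only [comp_apply, OpenPartialHomeomorph.refl_apply, id_eq, modelWithCornersSelf_coe,
    Prod.mk.injEq, and_true]
  have h1 : φ₁.symm (BoundaryManifold.tail n v) = ψ.symm (φ₀.symm (BoundaryManifold.tail n v)) := by
    simp [hφ₁]
  rw [h1, Diffeomorph.apply_symm_apply, φ₀.right_inv hv₁']

/-- **The re-indexed, reflected inverse `z ↦ (ψ (proj z), -height z) : M → B' × ℝ` of a long open
collar is a `C^∞` immersion at every point of `region`**, for a diffeomorphism `ψ : ∂M ≅ B'` (used
for the second piece of a gluing `M ∪_φ N`, whose collar runs downwards in the seam `∂M × ℝ` and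
is indexed through `φ⁻¹`): in the collar chart `leftChart (ψ ≫ φ₀)` and the product chart
`φ₀ × id` it is the linear isomorphism `v ↦ (tail v, -v 0)`. [folklore] -/
theorem isImmersionAtOfComplement_reindexNeg {B' : Type*} [TopologicalSpace B']
    [ChartedSpace (EuclideanSpace ℝ (Fin n)) B'] [IsManifold (𝓡 n) ∞ B']
    (ψ : b.carrier ≃ₘ⟮𝓡 n, 𝓡 n⟯ B') {z : M} (hz : z ∈ D.region) :
    Manifold.IsImmersionAtOfComplement PUnit (𝓡∂ (n + 1)) ((𝓡 n).prod 𝓘(ℝ, ℝ)) ∞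
      (fun z => (ψ (D.proj z), -D.height z)) z := by
  set φ₀ := chartAt (EuclideanSpace ℝ (Fin n)) (ψ (D.proj z)) with hφ₀def
  have hφ₀ : φ₀ ∈ IsManifold.maximalAtlas (𝓡 n) ∞ B' :=
    IsManifold.chart_mem_maximalAtlas (ψ (D.proj z))
  set φ₁ := ψ.toHomeomorph.toOpenPartialHomeomorph ≫ₕ φ₀ with hφ₁def
  have hφ₁ : φ₁ ∈ IsManifold.maximalAtlas (𝓡 n) ∞ b.carrier :=
    trans_mem_maximalAtlas_of_diffeomorph ψ hφ₀
  have hrefl : OpenPartialHomeomorph.refl ℝ ∈ IsManifold.maximalAtlas 𝓘(ℝ, ℝ) ∞ ℝ :=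
    IsManifold.subset_maximalAtlas (by simp)
  have hcont : ContinuousOn (fun z => (ψ (D.proj z), -D.height z)) D.region :=
    (ψ.continuous.comp_continuousOn D.continuousOn_proj).prodMk D.continuousOn_height.neg
  refine Manifold.IsImmersionAtOfComplement.mk_of_continuousAt
    (hcont.continuousAt (D.isOpen_region.mem_nhds hz))
    ((ContinuousLinearEquiv.prodUnique ℝ _ PUnit).trans ((BoundaryManifold.consCLE n).symm.trans
      ((ContinuousLinearEquiv.refl ℝ _).prodCongr (ContinuousLinearEquiv.neg ℝ))))
    (D.leftChart φ₁) (φ₀.prod (OpenPartialHomeomorph.refl ℝ)) ?_ ?_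
    (D.leftChart_mem_maximalAtlas φ₁ hφ₁) (IsManifold.mem_maximalAtlas_prod hφ₀ hrefl) ?_
  · rw [leftChart_source]
    refine ⟨hz, ?_⟩
    rw [mem_preimage, hφ₁def, OpenPartialHomeomorph.trans_source,
      Homeomorph.toOpenPartialHomeomorph_source]
    exact ⟨mem_univ _, mem_chart_source _ (ψ (D.proj z))⟩
  · rw [OpenPartialHomeomorph.prod_source]
    exact ⟨mem_chart_source _ (ψ (D.proj z)), mem_univ _⟩
  · intro v hv
    refine (D.extend_prod_reindexNeg_leftChart_symm ψ φ₀ hv).trans ?_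
    rfl

end OpenCollar

end BoundaryData

end Literature.Topology.FourManifolds
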